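import Literature.MathematicalPhysics.QuantumFieldTheory.Balaban1983to89.B9Thm312WholeHolder
import Literature.MathematicalPhysics.QuantumFieldTheory.Balaban1983to89.B9CoRealizesHRel

/-!
# `Balaban1983to89.B9Thm312WholeHHolder` — [B9] Theorem 3.12 (p. 423): the HÖLDER MEMBER ‖ζ∇H(·, y′)‖_β of (3.133) for H, H₁ at one member
# and one configuration — its co-reading through the probes (relative to a block equivalence), the letter Φ^Y_β∘∇_UG₀Q*, and the bound from the
# perturbation series

T. Bałaban, *Propagators for lattice gauge theories in a background field*, Commun. Math. Phys. **99** (1985) 389–434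
[`Balaban1985BackgroundPropagators`, "B9"]; [4] = T. Bałaban, *Propagators and renormalization transformations for lattice
gauge theories. II*, Commun. Math. Phys. **96** (1984) 223–250 [`Balaban1984PropagatorsII`].

statement-level skeleton of published theorems with citation tags; proofs where landed; nothing here is a claim about the
Yang–Mills mass gap

THE PRINTED LOCI (verbatim).  (3.133) p. 422: *"|H_{μν}(x, y′)|, |∇H_{μν}(x, y′)|, ‖ζ∇H(·, y′)‖_β ≦ O(1)[1, (Lʲη)⁻¹, (‖ζ‖^ξ_β + |ζ|)(Lʲη)^{−1−β}]
(L^{j′}η)^{−d}e^{−(1/2)δ₁d(y,y′)}, for x ∈ Δ(y), or ζ ∈ C^∞₀(Δ̃(y)), y ∈ Λ_j, y′ ∈ Λ_{j′}"*; p. 422: *"The above inequality [(3.132)] together with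
Theorem 3.3 for G, with the exception of the inequality involving the covariant Laplace operator in (3.42), give (3.133)"*; (3.126) p. 420:
*"HB = GQ*(QGQ*)⁻¹B"*; (3.129) p. 421; p. 423: *"From (3.129) and (3.132) with G₁ instead of G we get the inequalities (3.133) for H₁"*.

WHY THIS FILE.  After `…B9Thm312WholeLeafAll.thm312Printed_of_stepAll` the ONLY displayed member of row 20 is the third quantity of (3.133) —
the Hölder seminorm ‖ζ∇H(·,y′)‖_β of the kernel columns of H = GQ*(QGQ*)⁻¹ and H₁.  Print derives it from Theorem 3.3 for G ((3.43)) and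
(3.132); the tree PROVES (3.43) for G from the schemas (`…Holder.probe43L_cNormR`).  This file supplies the kernel-column reading and the
composition:
* §1 `CoReadsHHolderRel Hk U d Rel 𝔭 bv A` — the CO-READING of `Hk.h` (the third (3.133) quantity) by the model operator A = ∇_U∘H through n06-k's
  probes Φ^Y_β(U), RELATIVE to a block equivalence on the output side (the species of `B9CoRealizesHRel.CoRealizesHRel` for the sup members:
  test vectors at ONE coarse input point y′ normalised by (L^{j′}η)^{−d}, probes anchored in the class of y), and its engine
  `hkh_le_of_hasMajorantHom_rel` (a probe majorant saturated in the output argument ⇒ the printed line).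
* §2 `LettersHH 𝔬 𝔭 R₀ H₀ hlen Bq δ₃ U` — ONE letter of printed shape: the Hölder probe of ∇_UG₀Q* (Theorem 3.3's (3.43)₁ for G₀ applied
  after the local bounded operator Q*, the Hölder twin of `B9Thm312WholeH.LettersH.dgQs`), from 𝔠_Z^{(0)} into the probe class 𝔠_P^{(β−1)}.
* §3 ★ `hkh_of_step` — ONE MEMBER, ONE U, H = A∘Q*∘C with A = G₀ + G₀TA: Φ^Y_β∘∇_U∘H = (Φ^Y_β∘∇_UG₀Q*)∘C + (Φ^Y_β∘∇_UG₀T)∘H (one resolvent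
  identity), two compositions ([4] (2.54)+(2.61)) with the (3.132) letter C : 𝔠_Z^{(−2)} → 𝔠_Z^{(0)} and the proved entry H : 𝔠_Z^{(−2)} → 𝔠^{(−2)}
  (`B9Thm312WholeH.H_entry0`), one scale transfer of the class ratio (Lʲη∕L^{j′}η)² ((2.60)), then §1: `Hk.h U β ζ y′ ≦ C_β·(‖ζ‖+|ζ|)·
  (Lʲη)^{−(1+β)}(L^{j′}η)^{−d}e^{−(1−α)ρd(y,y′)}` with C_β = (B_q(β)B₃c + θ_H·K_H·c)·Λ.
The leaf with NO displayed residual is the sequel `…B9Thm312WholeLeafComplete`.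

HONEST SCOPE.  Nothing of [B9] or [4] is asserted: the reading schema, the letter, the step and the entry majorants are HYPOTHESES of printed ∕
definitional shape; the content is bookkeeping, kernel-checked.  NOT a node discharge, NOT summit progress; one finite lattice at a time;
nothing continuum, nothing about the mass gap.  Cell `pub-ymgap` (HUMAN RULING D-0062), Track A node N06 [B9], N06-ASSIGNMENT v1 row 20
(bundle F7), seat `pub-ymgap-dag-n06-l` (g4), 2026-08-27.
-/

namespace Literature.MathematicalPhysics.QuantumFieldTheory.Balaban1983to89.B9Thm312WholeHHolder

open Literature.MathematicalPhysics.QuantumFieldTheory.Balaban1983to89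
open Finset B6RandomWalk B6RandomWalkHom B9Thm34Ext B9Thm37GlueCor36 B11SectG B9SectDSup
open B9Thm37AllNorms B9Thm37AllNormsInstances B9Thm312Whole B9Thm312WholeLeaf B9Thm312WholeLeft B9Thm312WholeH B9RWSums343Holder
open B9Ineq347 B9Thm312WholeClasses B9Thm312WholeHolder B9CoRealizesHRel

noncomputable section

/-! ## §1 The co-reading of the Hölder member of (3.133) through the probes, relative to a block equivalence -/

section Schema

variable {g : B9.Geometry} {B : B9.Backgrounds} {X Y PX PY : Type} [Fintype X] [Fintype Y] [Fintype PX] [Fintype PY] [Fintype g.Site]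

/-- **CO-READING OF THE HÖLDER QUANTITY `Hk.h` OF AN H-KERNEL ((3.133), third member: ‖ζ∇H(·,y′)‖_β) BY A MODEL OPERATOR A = ∇_U∘H THROUGH THE
PROBES, RELATIVE TO A BLOCK EQUIVALENCE `Rel` ON THE OUTPUT SIDE.**  Print, (3.133) p. 422: the kernel column H(·,y′), y′ ∈ Λ_{j′}, carries
(L^{j′}η)^{−d}; the bounded quantity is ‖ζ∇H(·,y′)‖_β for ζ ∈ C₀^∞(Δ̃(y)) against (‖ζ‖^ξ_β + |ζ|)·(…).  Typed (the species of
`B9CoRealizesHRel.CoRealizesHRel` and of n06-k's `H1ReadsRel`): `obs` — for ζ ∈ C₀^∞(Δ̃(y)), `Hk.h U β ζ y′ ≦ c·(‖ζ‖^ξ_β + |ζ|)` whenever every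
probe anchored IN THE CLASS OF y is ≦ c·(L^{j′}η)^{d} on A b for every test vector b supported on the fibre of the ONE coarse point y′ with
|b| ≦ 1.  A HYPOTHESIS SCHEMA on how a model instantiates `HKernel.h`; nothing asserted. [cite: Balaban1985BackgroundPropagators, (3.133) p.422 + (3.40) p.397] -/
structure CoReadsHHolderRel {v : Type} (Hk : B9.HKernel g B) (U : B.Cfg) (d : ℕ) (Rel : g.Site → g.Site → Prop)
    (𝔭 : HolderProbes g B X Y PX PY) (bv : v → g.Site) (A : (v → ℝ) →ₗ[ℝ] (Y → ℝ)) : Prop where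
  cutH_nonneg : ∀ (β : ℝ) (ζ : g.Cut), 0 ≤ g.cutH β ζ
  obs : ∀ (β : ℝ) (ζ : g.Cut) (y y' : g.Site) (c : ℝ), 0 ≤ c → g.cutInT ζ y →
    (∀ b : v → ℝ, (∀ x', bv x' ≠ y' → b x' = 0) → (∀ x', |b x'| ≤ 1) →
      ∀ p : PY, Rel (𝔭.blkPY p) y → |𝔭.ΦY U β (A b) p| ≤ c * (g.len y') ^ (d : ℝ)) →
    Hk.h U β ζ y' ≤ c * g.cutH β ζ

omit [Fintype X] [Fintype Y] [Fintype PX] [Fintype PY] in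
/-- **A probe majorant SATURATED IN THE OUTPUT ARGUMENT + the relative co-reading ⇒ the Hölder line of (3.133)**: if Φ^Y_β(U)∘A has the
two-space sup majorant K′ ≧ 0 with K′(a, y′) = K′(a′, y′) for `Rel a a′`, then for ζ ∈ C₀^∞(Δ̃(y)):
`Hk.h U β ζ y′ ≦ K′(y, y′)·(L^{j′}η)^{−d}·(‖ζ‖^ξ_β + |ζ|)`. [cite: Balaban1985BackgroundPropagators, (3.133) p.422; Balaban1984PropagatorsII, (2.51) p.232] -/
theorem hkh_le_of_hasMajorantHom_rel {v : Type} [Fintype v] {Hk : B9.HKernel g B} {U : B.Cfg} {d : ℕ}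
    {Rel : g.Site → g.Site → Prop} {𝔭 : HolderProbes g B X Y PX PY} {bv : v → g.Site} {A : (v → ℝ) →ₗ[ℝ] (Y → ℝ)}
    {R₀ : ℝ} {H₀ : Prop} (hC : CoReadsHHolderRel Hk U d Rel 𝔭 bv A) (hlen : ∀ y : g.Site, 0 < g.len y) {β : ℝ}
    {K' : g.Site → g.Site → ℝ} (hK' : ∀ a b, 0 ≤ K' a b) (hsat : ∀ a a' b, Rel a a' → K' a b = K' a' b)
    (hA : HasMajorantHom (g := toB6 g R₀ H₀) bv 𝔭.blkPY (𝔭.ΦY U β ∘ₗ A) K') {ζ : g.Cut} {y : g.Site} (y' : g.Site)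
    (hζ : g.cutInT ζ y) :
    Hk.h U β ζ y' ≤ K' y y' * (g.len y') ^ (-(d : ℝ)) * g.cutH β ζ := by
  -- adapted from `B9CoRealizesHRel.hk_le_of_hasMajorantHom_rel` (same seat)
  refine hC.obs β ζ y y' _ (mul_nonneg (hK' y y') (Real.rpow_nonneg (hlen y').le _)) hζ fun b hoff hb p hp => ?_
  have hbs : BlockSupp (g := toB6 g R₀ H₀) bv b y' 1 := ⟨zero_le_one, fun x' _ => hb x', hoff⟩
  have h := hA y' b 1 hbs p
  rw [mul_one, hsat _ _ _ hp, LinearMap.comp_apply] at h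
  calc |𝔭.ΦY U β (A b) p| ≤ K' y y' := h
    _ = K' y y' * (g.len y') ^ (-(d : ℝ)) * (g.len y') ^ (d : ℝ) := by
        rw [mul_assoc, ← Real.rpow_add (hlen y'), neg_add_cancel, Real.rpow_zero, mul_one]

end Schema

/-! ## §2 The letter: the Hölder probe of ∇_UG₀Q* -/

section Letter

variable {g : B9.Geometry} {B : B9.Backgrounds} {X Y Z W PX PY : Type} [Fintype X] [Fintype Z] [Fintype PY] [Fintype g.Site]

/-- **THE HÖLDER PROBE OF ∇_UG₀Q\*** — a letter of printed shape (nothing asserted): for 0 ≦ β < 1, Φ^Y_β(U)∘∇_U∘G₀∘Q* has the block majorant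
B_q(β)·e^{−δ₃d} from 𝔠_Z^{(0)} (coarse fields b = the columns (QGQ*)⁻¹δ_{y′}, sup size) into the probe class 𝔠_P^{(β−1)} — Theorem 3.3's (3.43)₁
for G₀ (*"‖ζ∇_UG′λ‖_β ≦ B₀(β)(Lʲη)^{1−β}(…)e^{−δ₀d}|λ|"*) applied to λ = Q*b, Q* local and bounded ((3.110)); the Hölder twin of
`B9Thm312WholeH.LettersH.dgQs` and the probe version of p. 422's *"The above inequality together with Theorem 3.3 for G … give (3.133)"*.
[cite: Balaban1985BackgroundPropagators, (3.133) p.422 + (3.126) p.420 + (3.43) p.398 + Thm 3.3 p.399] -/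
structure LettersHH (𝔬 : Ops g B X Y Z W) (𝔭 : HolderProbes g B X Y PX PY) (R₀ : ℝ) (H₀ : Prop)
    (hlen : ∀ y : g.Site, 0 ≤ g.len y) (Bq : ℝ → ℝ) (δ₃ : ℝ) (U : B.Cfg) : Prop where
  pQ : ∀ β : ℝ, 0 ≤ β → β < 1 → HasMaj (cNormR R₀ H₀ 𝔬.blkZ hlen 0) (cNormR R₀ H₀ 𝔭.blkPY hlen (β - 1))
    ((𝔭.ΦY U β ∘ₗ 𝔬.D U ∘ₗ 𝔬.G0 U) ∘ₗ 𝔬.Qstar U) (fun a b => Bq β * Real.exp (-(δ₃ * g.dist a b)))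

end Letter

/-! ## §3 One member, one U: the Hölder member of (3.133) for H = A∘Q*∘C -/

section OneMember

variable {g : B9.Geometry} {B : B9.Backgrounds} {X Y Z PX PY : Type}
variable [Fintype X] [Fintype Y] [Fintype Z] [Fintype PX] [Fintype PY] [Fintype g.Site]
variable {R₀ : ℝ} {H₀ : Prop}

omit [Fintype Y] [Fintype PX] in
/-- **Φ^Y_β∘∇_U∘H IN THE WEIGHTED CLASSES**: with H = A∘Q*∘C ((3.126)) and A = G₀ + G₀TA ((3.130)), Φ∘∇_U∘H = (Φ∘∇_UG₀Q*)∘C + (Φ∘∇_UG₀T)∘H; the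
letter `hpQ` (B_q e^{−δ₃d}, 𝔠_Z^{(0)} → 𝔠_P^{(β−1)}) after the (3.132) letter C (B₃e^{−δ₃d}, 𝔠_Z^{(−2)} → 𝔠_Z^{(0)}), and the probe step `hpY`
(θ_He^{−δ_Kd}, 𝔠^{(−2)} → 𝔠_P^{(β−1)}) after the proved entry H (K_He^{−ρd}, 𝔠_Z^{(−2)} → 𝔠^{(−2)}): majorant (B_qB₃c + θ_HK_Hc)·e^{−ρd} from 𝔠_Z^{(−2)}
into 𝔠_P^{(β−1)} (ρ + σ ≦ δ₃, ρ + σ ≦ δ_K). [cite: Balaban1985BackgroundPropagators, (3.133) p.422 + (3.126) p.420 + (3.130) p.421 + (3.132) p.422; Balaban1984PropagatorsII, Lemma 2.1 p.234] -/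
theorem hkh_cNormR (hG : GeoOK g) {blk : X → g.Site} {blkZ : Z → g.Site} {blkP : PY → g.Site} {G0 T A : Module.End ℝ (X → ℝ)}
    {E : (X → ℝ) →ₗ[ℝ] (PY → ℝ)} {Qs : (Z → ℝ) →ₗ[ℝ] (X → ℝ)} {Cop : Module.End ℝ (Z → ℝ)} {Hop : (Z → ℝ) →ₗ[ℝ] (X → ℝ)}
    {θH Bq B₃ KH β δ₃ δK ρ σ c : ℝ} (hrow : RowSum (toB6 g R₀ H₀) σ c)
    (hθH : 0 ≤ θH) (hBq : 0 ≤ Bq) (hB₃ : 0 ≤ B₃) (hKH : 0 ≤ KH) (hσ : 0 ≤ σ) (hρ : 0 ≤ ρ) (hρ₃ : ρ + σ ≤ δ₃)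
    (hρδ : ρ + σ ≤ δK)
    (hpQ : HasMaj (cNormR R₀ H₀ blkZ hG.lenle 0) (cNormR R₀ H₀ blkP hG.lenle (β - 1)) ((E ∘ₗ G0) ∘ₗ Qs)
      (fun a b => Bq * Real.exp (-(δ₃ * g.dist a b))))
    (hCop : HasMaj (cNorm R₀ H₀ blkZ hG.lenle 2) (cNorm R₀ H₀ blkZ hG.lenle 0) Cop (fun a b => B₃ * Real.exp (-(δ₃ * g.dist a b))))
    (hpY : HasMaj (cNormR R₀ H₀ blk hG.lenle (-2)) (cNormR R₀ H₀ blkP hG.lenle (β - 1)) ((E ∘ₗ G0) ∘ₗ T)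
      (fun a b => θH * Real.exp (-(δK * g.dist a b))))
    (hH : HasMaj (cNorm R₀ H₀ blkZ hG.lenle 2) (cNorm R₀ H₀ blk hG.lenle 2) Hop (fun a b => KH * Real.exp (-(ρ * g.dist a b))))
    (hHop : Hop = A ∘ₗ (Qs ∘ₗ Cop)) (hfix : A = G0 + G0 ∘ₗ T ∘ₗ A) :
    HasMaj (cNormR R₀ H₀ blkZ hG.lenle (-2)) (cNormR R₀ H₀ blkP hG.lenle (β - 1)) (E ∘ₗ Hop)
      (fun a b => (Bq * B₃ * c + θH * KH * c) * Real.exp (-(ρ * g.dist a b))) := by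
  have htri : Triangle254 (toB6 g R₀ H₀) := fun a b c => hG.tri a b c
  -- the letter C and the entry H in the real-weight classes
  have hC' : HasMaj (cNormR R₀ H₀ blkZ hG.lenle (-2)) (cNormR R₀ H₀ blkZ hG.lenle 0) Cop
      (fun a b => B₃ * Real.exp (-(δ₃ * g.dist a b))) := by
    have h := hasMaj_toR hG hCop
    simp only [Nat.cast_zero, neg_zero, Nat.cast_ofNat] at h
    exact h
  have hH' : HasMaj (cNormR R₀ H₀ blkZ hG.lenle (-2)) (cNormR R₀ H₀ blk hG.lenle (-2)) Hop
      (fun a b => KH * Real.exp (-(ρ * g.dist a b))) := by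
    have h := hasMaj_toR hG hH
    simp only [Nat.cast_ofNat] at h
    exact h
  -- (Φ∇G₀Q*)∘C : 𝔠_Z^{(−2)} → 𝔠_P^{(β−1)}
  have h1 : HasMaj (cNormR R₀ H₀ blkZ hG.lenle (-2)) (cNormR R₀ H₀ blkP hG.lenle (β - 1)) (((E ∘ₗ G0) ∘ₗ Qs) ∘ₗ Cop)
      (fun a b => (cNormR R₀ H₀ blkZ hG.lenle 0 (X := Z)).κ * Bq * B₃ * c * Real.exp (-(ρ * g.dist a b))) :=
    hasMaj_comp_exp htri hG.dnn hrow hBq hB₃ hρ (by linarith) hρ₃ hpQ hC'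
  simp only [cNormR_κ, one_mul] at h1
  -- (Φ∇G₀T)∘H : 𝔠_Z^{(−2)} → 𝔠_P^{(β−1)}
  have h2 : HasMaj (cNormR R₀ H₀ blkZ hG.lenle (-2)) (cNormR R₀ H₀ blkP hG.lenle (β - 1)) (((E ∘ₗ G0) ∘ₗ T) ∘ₗ Hop)
      (fun a b => (cNormR R₀ H₀ blk hG.lenle (-2) (X := X)).κ * θH * KH * c * Real.exp (-(ρ * g.dist a b))) :=
    hasMaj_comp_exp htri hG.dnn hrow hθH hKH hρ le_rfl hρδ hpY hH'
  simp only [cNormR_κ, one_mul] at h2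
  have hsum := h1.add h2
  have hop : E ∘ₗ Hop = ((E ∘ₗ G0) ∘ₗ Qs) ∘ₗ Cop + ((E ∘ₗ G0) ∘ₗ T) ∘ₗ Hop := by
    rw [hHop]
    conv_lhs => rw [comp_fix_rightEntry (Qs ∘ₗ Cop) hfix]
    rw [LinearMap.comp_add]
    exact LinearMap.ext fun _ => rfl
  rw [← hop] at hsum
  exact hsum.mono fun a b => le_of_eq (by ring)

omit [Fintype Y] [Fintype PX] in
/-- ★ **THE HÖLDER MEMBER OF (3.133) FOR H (OR H₁) AT ONE MEMBER AND ONE CONFIGURATION, PRINTED SHAPE** — *"‖ζ∇H(·,y′)‖_β ≦ O(1)(‖ζ‖^ξ_β +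
|ζ|)(Lʲη)^{−1−β}(L^{j′}η)^{−d}e^{−(1/2)δ₁d(y,y′)}, ζ ∈ C₀^∞(Δ̃(y))"*: from `hkh_cNormR` (the weighted majorant of Φ^Y_β∘∇_U∘H), the transfer of the class
ratio (Lʲη∕L^{j′}η)² by [4] (2.60) at (ρ, α) (constant Λ) and the relative co-reading `CoReadsHHolderRel`: `Hk.h U β ζ y′ ≦ (C·Λ)·(‖ζ‖+|ζ|)·
(Lʲη)^{−(1+β)}·(L^{j′}η)^{−d}·e^{−(1−α)ρd(y,y′)}`, C = B_qB₃c + θ_HK_Hc. [cite: Balaban1985BackgroundPropagators, (3.133) p.422 + p.398 (remark after (3.47)); Balaban1984PropagatorsII, (2.60) p.234] -/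
theorem hkh_of_step (hG : GeoOK g) {Hk : B9.HKernel g B} {U : B.Cfg} {d : ℕ} {Rel : g.Site → g.Site → Prop}
    (𝔭 : HolderProbes g B X Y PX PY) {blk : X → g.Site} {blkZ : Z → g.Site} {G0 T A : Module.End ℝ (X → ℝ)}
    {Dop : (X → ℝ) →ₗ[ℝ] (Y → ℝ)} {Qs : (Z → ℝ) →ₗ[ℝ] (X → ℝ)} {Cop : Module.End ℝ (Z → ℝ)} {Hop : (Z → ℝ) →ₗ[ℝ] (X → ℝ)}
    {θH Bq B₃ KH β δ₃ δK ρ α Λ σ c : ℝ} (hrow : RowSum (toB6 g R₀ H₀) σ c)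
    (hθH : 0 ≤ θH) (hBq : 0 ≤ Bq) (hB₃ : 0 ≤ B₃) (hKH : 0 ≤ KH) (hΛ : 0 ≤ Λ) (hσ : 0 ≤ σ) (hρ : 0 ≤ ρ) (hρ₃ : ρ + σ ≤ δ₃)
    (hρδ : ρ + σ ≤ δK)
    (hC : CoReadsHHolderRel Hk U d Rel 𝔭 blkZ (Dop ∘ₗ Hop))
    (hRdist : ∀ a a' b, Rel a a' → g.dist a b = g.dist a' b) (hRlen : ∀ a a', Rel a a' → g.len a = g.len a')
    (hST : ScaleTransfer g ρ α Λ (fun y => g.len y ^ (2 : ℝ)))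
    (hpQ : HasMaj (cNormR R₀ H₀ blkZ hG.lenle 0) (cNormR R₀ H₀ 𝔭.blkPY hG.lenle (β - 1)) ((𝔭.ΦY U β ∘ₗ Dop ∘ₗ G0) ∘ₗ Qs)
      (fun a b => Bq * Real.exp (-(δ₃ * g.dist a b))))
    (hCop : HasMaj (cNorm R₀ H₀ blkZ hG.lenle 2) (cNorm R₀ H₀ blkZ hG.lenle 0) Cop (fun a b => B₃ * Real.exp (-(δ₃ * g.dist a b))))
    (hpY : HasMaj (cNormR R₀ H₀ blk hG.lenle (-2)) (cNormR R₀ H₀ 𝔭.blkPY hG.lenle (β - 1)) ((𝔭.ΦY U β ∘ₗ Dop ∘ₗ G0) ∘ₗ T)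
      (fun a b => θH * Real.exp (-(δK * g.dist a b))))
    (hH : HasMaj (cNorm R₀ H₀ blkZ hG.lenle 2) (cNorm R₀ H₀ blk hG.lenle 2) Hop (fun a b => KH * Real.exp (-(ρ * g.dist a b))))
    (hHop : Hop = A ∘ₗ (Qs ∘ₗ Cop)) (hfix : A = G0 + G0 ∘ₗ T ∘ₗ A) :
    ∀ (ζ : g.Cut) (y y' : g.Site), g.cutInT ζ y →
      Hk.h U β ζ y' ≤ ((Bq * B₃ * c + θH * KH * c) * Λ) * g.cutH β ζ * (g.len y) ^ (-(1 + β)) * (g.len y') ^ (-(d : ℝ)) *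
        Real.exp (-((1 - α) * ρ * g.dist y y')) := by
  intro ζ y y' hζ
  have hc : 0 ≤ c ∨ IsEmpty g.Site := by
    by_cases hne : Nonempty g.Site
    · exact Or.inl (hrow.nonneg hne.some)
    · exact Or.inr (not_nonempty_iff.mp hne)
  rcases hc with hc | hemp
  swap
  · exact (hemp.false y).elim
  set K : ℝ := Bq * B₃ * c + θH * KH * c with hK
  have hK0 : 0 ≤ K := add_nonneg (mul_nonneg (mul_nonneg hBq hB₃) hc) (mul_nonneg (mul_nonneg hθH hKH) hc)
  -- the weighted majorant and its two-space form: K·(Lʲη)^{1−β}·(L^{j′}η)^{−2}·e^{−ρd}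
  have hW := hkh_cNormR (E := 𝔭.ΦY U β ∘ₗ Dop) hG hrow hθH hBq hB₃ hKH hσ hρ hρ₃ hρδ hpQ hCop hpY hH hHop hfix
  have h' := hasMajorantHom_of_hasMaj_cNormR hG (fun a b => mul_nonneg hK0 (Real.exp_nonneg _)) hW
  -- the transfer of (Lʲη ∕ L^{j′}η)²
  have hbound : ∀ a b : g.Site, K * Real.exp (-(ρ * g.dist a b)) * g.len a ^ (-(β - 1)) * g.len b ^ (-2 : ℝ) ≤
      K * Λ * g.len a ^ (-(1 + β)) * Real.exp (-((1 - α) * ρ * g.dist a b)) := by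
    intro a b
    have ha : 0 < g.len a := hG.lenpos a
    have hb : 0 < g.len b := hG.lenpos b
    have ht := hST b a
    rw [hG.symm b a] at ht
    -- (Lʲη)^{1−β} = (Lʲη)^{−(1+β)} · (Lʲη)²
    have hsplitA : g.len a ^ (-(β - 1)) = g.len a ^ (-(1 + β)) * g.len a ^ (2 : ℝ) := by
      rw [← Real.rpow_add ha]; congr 1; ring
    have hsplit : Real.exp (-(ρ * g.dist a b)) = Real.exp (-((1 - α) * ρ * g.dist a b)) * Real.exp (-(α * ρ * g.dist a b)) := by
      rw [← Real.exp_add]; congr 1; ring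
    have hratio : Real.exp (-(α * ρ * g.dist a b)) * g.len a ^ (2 : ℝ) * g.len b ^ (-2 : ℝ) ≤ Λ := by
      rw [Real.rpow_neg hb.le, ← div_eq_mul_inv, div_le_iff₀ (Real.rpow_pos_of_pos hb _)]
      exact ht
    have hnn : 0 ≤ K * Real.exp (-((1 - α) * ρ * g.dist a b)) * g.len a ^ (-(1 + β)) :=
      mul_nonneg (mul_nonneg hK0 (Real.exp_nonneg _)) (Real.rpow_nonneg ha.le _)
    calc K * Real.exp (-(ρ * g.dist a b)) * g.len a ^ (-(β - 1)) * g.len b ^ (-2 : ℝ)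
        = K * Real.exp (-((1 - α) * ρ * g.dist a b)) * g.len a ^ (-(1 + β)) *
            (Real.exp (-(α * ρ * g.dist a b)) * g.len a ^ (2 : ℝ) * g.len b ^ (-2 : ℝ)) := by rw [hsplitA, hsplit]; ring
      _ ≤ K * Real.exp (-((1 - α) * ρ * g.dist a b)) * g.len a ^ (-(1 + β)) * Λ := mul_le_mul_of_nonneg_left hratio hnn
      _ = K * Λ * g.len a ^ (-(1 + β)) * Real.exp (-((1 - α) * ρ * g.dist a b)) := by ring
  have hA := hasMajorantHom_mono (g := toB6 g R₀ H₀) blkZ 𝔭.blkPY h' hbound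
  have hA' : HasMajorantHom (g := toB6 g R₀ H₀) blkZ 𝔭.blkPY (𝔭.ΦY U β ∘ₗ (Dop ∘ₗ Hop))
      (fun a b => K * Λ * g.len a ^ (-(1 + β)) * Real.exp (-((1 - α) * ρ * g.dist a b))) := hA
  have h := hkh_le_of_hasMajorantHom_rel (R₀ := R₀) (H₀ := H₀) hC hG.lenpos
    (fun a b => mul_nonneg (mul_nonneg (mul_nonneg hK0 hΛ) (Real.rpow_nonneg (hG.lenle a) _)) (Real.exp_nonneg _))
    (fun a a' b hr => by rw [hRdist a a' b hr, hRlen a a' hr]) hA' y' hζ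
  calc Hk.h U β ζ y' ≤ K * Λ * g.len y ^ (-(1 + β)) * Real.exp (-((1 - α) * ρ * g.dist y y')) * (g.len y') ^ (-(d : ℝ)) *
        g.cutH β ζ := h
    _ = (K * Λ) * g.cutH β ζ * (g.len y) ^ (-(1 + β)) * (g.len y') ^ (-(d : ℝ)) * Real.exp (-((1 - α) * ρ * g.dist y y')) := by
        ring

end OneMember

end

end Literature.MathematicalPhysics.QuantumFieldTheory.Balaban1983to89.B9Thm312WholeHHolder
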